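import Summits.ValiantsHypothesis.ValiantsHypothesis.Theorems.DepthWindowJumpPresent
import Summits.ValiantsHypothesis.ValiantsHypothesis.Theorems.DepthWindowSparseTwoLevelGood
import Mathlib.Logic.Equiv.Fin.Basic
import Mathlib.Algebra.BigOperators.Ring.Finset
import HarnessLib

/-!
# Route `DepthWindow`, g8 — FUSED path products (second piece of the fused form (iv′))

Second kernel piece of the fused variant of piece (iv) (lens-4 NODE-v8 §12, SPEC (iv′)): with the
layers PRESENTED (`Theorems/DepthWindowJumpPresent.lean`), the weight of an inner path `s` of block
`q` through the padded jump layers DISTRIBUTES into a `Σ Π` over the term choices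
`σ : Fin b → Fin S`:
`pathWeight … s = Σ_σ C (fusedCoef … s σ) · ∏_{u' < b·m} (fusedLeaf … s σ u').eval V`
(`pathWeight_eq_sum_fused`), the leaf rows being the concatenated operand rows (flattened by
`finProdFinEquiv`), of weight `(s_b)₁ - (s₀)₁` (`prod_fusedLeaf_isWeightedHomogeneous`: monotone
paths telescope, a decreasing step kills its row), with references / depths those of the presented
operands.  So the fused leaves sit at depth `D₀` — one product level lower than the component
operands of the unfused `exists_gates_prod_component`.  Pure bookkeeping; nothing here bears on
`VP ≠ VNP`.

[cite: LimayeSrinivasanTavenas2025, Lemma 11] [cite: Burgisser2000, Def. 2.1]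
-/

set_option linter.dupNamespace false

namespace Summit.ValiantsHypothesis.ValiantsHypothesis.Theorems.DepthWindow

open Finset MvPolynomial Literature.Computability.AlgebraicComplexity ArithCircuit

variable {k : Type*} [CommRing k] {τ : Type*}

/-- The fused leaf row of block `q`, inner path `s`, term choices `σ`: slot `(u, j)` is operand `j`
of the chosen row of layer `q·b + u` between `s_u` and `s_{u+1}`. -/
def fusedLeaf (d t S m : ℕ) (op : ℕ → ℕ → Fin S → Fin m → Operand k τ) (κ a b : ℕ) (q : Fin a)
    (s : Fin (b + 1) → Fin (d + 1) × Fin (t + 1)) (σ : Fin b → Fin S) (u' : Fin (b * m)) :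
    Operand k τ :=
  layerOp d t S m op κ ((q : ℕ) * b + ((finProdFinEquiv.symm u').1 : ℕ))
    (s (finProdFinEquiv.symm u').1.castSucc) (s (finProdFinEquiv.symm u').1.succ)
    (σ (finProdFinEquiv.symm u').1) (finProdFinEquiv.symm u').2

/-- The fused coefficient of block `q`, inner path `s`, term choices `σ`. -/
noncomputable def fusedCoef (d t S : ℕ) (u0 : ℕ → k) (coef : ℕ → ℕ → Fin S → k) (κ a b : ℕ)
    (q : Fin a) (s : Fin (b + 1) → Fin (d + 1) × Fin (t + 1)) (σ : Fin b → Fin S) : k :=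
  ∏ u : Fin b, layerCoef d t S u0 coef κ ((q : ℕ) * b + (u : ℕ)) (s u.castSucc) (s u.succ) (σ u)

section Fused

variable (w : τ → ℕ) (d t S m : ℕ) (U : ℕ → MvPolynomial τ k) (u0 : ℕ → k)
  (coef : ℕ → ℕ → Fin S → k) (op : ℕ → ℕ → Fin S → Fin m → Operand k τ)
  (V : List (MvPolynomial τ k)) (D : List ℕ) (n D₀ : ℕ)

/-- Flattening the double product of the chosen rows into the fused leaf row. -/
theorem prod_fusedLeaf_eval (κ a b : ℕ) (q : Fin a) (s : Fin (b + 1) → Fin (d + 1) × Fin (t + 1))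
    (σ : Fin b → Fin S) :
    ∏ u' : Fin (b * m), (fusedLeaf d t S m op κ a b q s σ u').eval V =
      ∏ u : Fin b, ∏ j : Fin m,
        (layerOp d t S m op κ ((q : ℕ) * b + (u : ℕ)) (s u.castSucc) (s u.succ) (σ u) j).eval V := by
  rw [← Fintype.prod_equiv finProdFinEquiv
      (fun p : Fin b × Fin m => (fusedLeaf d t S m op κ a b q s σ (finProdFinEquiv p)).eval V)
      (fun u' => (fusedLeaf d t S m op κ a b q s σ u').eval V) (fun _ => rfl),
    Fintype.prod_prod_type]
  refine Fintype.prod_congr _ _ fun u => Fintype.prod_congr _ _ fun j => ?_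
  unfold fusedLeaf
  rw [Equiv.symm_apply_apply]

/-- **Fused path products.** [cite: LimayeSrinivasanTavenas2025, Lemma 11] -/
theorem pathWeight_eq_sum_fused (hS : 1 ≤ S)
    (h0 : ∀ l, l < t → weightedHomogeneousComponent w 0 (U l) = C (u0 l))
    (hpres : ∀ l ω, l < t → 1 ≤ ω → ω ≤ d →
      ∑ s : Fin S, C (coef l ω s) * ∏ j : Fin m, (op l ω s j).eval V =
        weightedHomogeneousComponent w ω (U l))
    (κ a b : ℕ) (q : Fin a) (s : Fin (b + 1) → Fin (d + 1) × Fin (t + 1)) :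
    pathWeight (fun u : Fin b =>
        padLayers (jumpMat w d t U) κ (a * b) ⟨(q : ℕ) * b + u, blockIndex_lt q u⟩) s =
      ∑ σ : Fin b → Fin S, C (fusedCoef d t S u0 coef κ a b q s σ) *
        ∏ u' : Fin (b * m), (fusedLeaf d t S m op κ a b q s σ u').eval V := by
  unfold pathWeight
  have step : ∀ u : Fin b,
      padLayers (jumpMat w d t U) κ (a * b) ⟨(q : ℕ) * b + u, blockIndex_lt q u⟩ (s u.castSucc) (s u.succ) =
        ∑ σu : Fin S, C (layerCoef d t S u0 coef κ ((q : ℕ) * b + (u : ℕ)) (s u.castSucc) (s u.succ) σu) *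
          ∏ j : Fin m, (layerOp d t S m op κ ((q : ℕ) * b + (u : ℕ)) (s u.castSucc) (s u.succ) σu j).eval V :=
    fun u => padLayers_eq_sum_present w d t S m U u0 coef op V hS h0 hpres κ (a * b) _ _ _
  simp only [step]
  rw [Fintype.prod_sum]
  refine Finset.sum_congr rfl fun σ _ => ?_
  rw [Finset.prod_mul_distrib, prod_fusedLeaf_eval d t S m op V κ a b q s σ]
  unfold fusedCoef
  rw [map_prod]

/-- A layer between states with decreasing degree has only dead rows (needs `1 ≤ m`). -/
theorem prod_layerOp_eval_eq_zero_of_lt (hm : 1 ≤ m) (κ i : ℕ) (x y : Fin (d + 1) × Fin (t + 1))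
    (σu : Fin S) (hxy : (y.1 : ℕ) < x.1) :
    ∏ j : Fin m, (layerOp d t S m op κ i x y σu j).eval V = 0 := by
  unfold layerOp jumpOp idOp
  by_cases hi : i < κ
  · simp only [if_pos hi]
    have hv : ¬ ((x.2 : ℕ) < y.2 ∧ (x.1 : ℕ) < y.1) := fun hv => by omega
    simp only [if_neg hv]
    exact Finset.prod_eq_zero (Finset.mem_univ (⟨0, hm⟩ : Fin m)) (by simp only [Operand.eval, C_0])
  · simp only [if_neg hi]
    have h' : ¬ (x = y ∧ (σu : ℕ) = 0) := fun h => by rw [h.1] at hxy; omega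
    simp only [if_neg h']
    exact Finset.prod_eq_zero (Finset.mem_univ (⟨0, hm⟩ : Fin m)) (by simp only [Operand.eval, C_0])

/-- **Weights of the fused leaf rows**: `(s_b)₁ - (s₀)₁`. -/
theorem prod_fusedLeaf_isWeightedHomogeneous (hm : 1 ≤ m)
    (hw : ∀ l ω s, l < t → 1 ≤ ω → ω ≤ d →
      IsWeightedHomogeneous w (∏ j : Fin m, (op l ω s j).eval V) ω)
    (κ a b : ℕ) (q : Fin a) (s : Fin (b + 1) → Fin (d + 1) × Fin (t + 1)) (σ : Fin b → Fin S) :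
    IsWeightedHomogeneous w (∏ u' : Fin (b * m), (fusedLeaf d t S m op κ a b q s σ u').eval V)
      (((s (Fin.last b)).1 : ℕ) - (s 0).1) := by
  rw [prod_fusedLeaf_eval d t S m op V κ a b q s σ]
  by_cases hmono : ∀ u : Fin b, ((s u.castSucc).1 : ℕ) ≤ (s u.succ).1
  · have h := IsWeightedHomogeneous.prod Finset.univ
      (fun u : Fin b => ∏ j : Fin m,
        (layerOp d t S m op κ ((q : ℕ) * b + (u : ℕ)) (s u.castSucc) (s u.succ) (σ u) j).eval V)
      (fun u => ((s u.succ).1 : ℕ) - (s u.castSucc).1)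
      fun u _ => prod_layerOp_isWeightedHomogeneous w d t S m op V hm hw κ _ _ _ (σ u)
    rwa [sum_steps_eq_of_stepMono b (fun u => ((s u).1 : ℕ)) hmono] at h
  · simp only [not_forall, not_le] at hmono
    obtain ⟨u, hu⟩ := hmono
    rw [Finset.prod_eq_zero (Finset.mem_univ u)
      (prod_layerOp_eval_eq_zero_of_lt d t S m op V hm κ _ _ _ (σ u) hu)]
    exact isWeightedHomogeneous_zero k w _

/-- References of the fused leaves. -/
theorem fusedLeaf_refsBelow
    (hrefs : ∀ l ω s j, l < t → 1 ≤ ω → ω ≤ d → (op l ω s j).RefsBelow n)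
    (κ a b : ℕ) (q : Fin a) (s : Fin (b + 1) → Fin (d + 1) × Fin (t + 1)) (σ : Fin b → Fin S)
    (u' : Fin (b * m)) : (fusedLeaf d t S m op κ a b q s σ u').RefsBelow n := by
  unfold fusedLeaf
  exact layerOp_refsBelow d t S m op n hrefs κ _ _ _ _ _

/-- Depth of the fused leaves. -/
theorem fusedLeaf_depthIn
    (hdp : ∀ l ω s j, l < t → 1 ≤ ω → ω ≤ d → (op l ω s j).depthIn D ≤ D₀)
    (κ a b : ℕ) (q : Fin a) (s : Fin (b + 1) → Fin (d + 1) × Fin (t + 1)) (σ : Fin b → Fin S)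
    (u' : Fin (b * m)) : (fusedLeaf d t S m op κ a b q s σ u').depthIn D ≤ D₀ := by
  unfold fusedLeaf
  exact layerOp_depthIn d t S m op D D₀ hdp κ _ _ _ _ _

end Fused

end Summit.ValiantsHypothesis.ValiantsHypothesis.Theorems.DepthWindow
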